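import Summits.AtomisticToContinuum.HydrodynamicLimit.Theorems.MourreKoopmanChargesOneBodyCompletenessTorusMoments
import Summits.AtomisticToContinuum.HydrodynamicLimit.Theorems.AntiMazurCoboundariesBoltzmannGreenKuboGibbsStatics
import HarnessLib

/-!
# `OneBodyCompleteness` · line `registered`, stub `torusStaticVariance`:
# the exact equal-time variance of the one-body empirical field under the canonical law on `𝕋³`

Support file for the crux item stmt-AtomisticToContinuum-9583 (`OneBodyCompleteness`, route
`MourreKoopmanCharges` of `AtomisticToContinuum/HydrodynamicLimit`), proving the registered sub-goal
`torusStaticVariance` of the skeleton `Cruxes/OneBodyCompleteness/Lines/birth.lean`.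

Setting: `N + 1` hard spheres of diameter `hsDiameter σ N` on `𝕋³` under the canonical ("rung-0",
constant-profile) law `G = localGibbsLaw σ 1 0 θ N Φ` (`0 < σ < 1/2`, `0 < θ`), a continuous
polynomially bounded velocity profile `h` with `∫ h M_θ = 0`, a continuous `χ` on `𝕋³`, and the
one-body empirical field `A(z) = ∫ χ(y.1) h(y.2) d(empiricalMeasure z) = (N+1)⁻¹ Σᵢ χ(xᵢ) h(vᵢ)`.

Claim: `(N+1) · E_G[A(Φ_0 z) · A(z)] = (∫ χ²) · ∫ h² M_θ` for every `N`.

* `Φ_0 = id` `G`-a.e. (`ae_mem_good_localGibbsLaw`, `HardSphereFlow.flow_zero`), so the left side is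
  `(N+1) · E_G[A²]`;
* the exact equal-time Gibbs statics of one-body fields
  (`BoltzmannGreenKuboGibbsStatics.stub_gibbsStatics`: i.i.d. `N(0, θ id)` velocities independent of
  the positions, Haar one-particle position marginal, cross terms killed by `∫ h M_θ = 0`) applied to
  the normalised test function `K⁻¹ χ` (`|K⁻¹ χ| ≤ 1`) and the rescaled profile `w ↦ h(√θ w)` gives
  `E_G[(Σᵢ χ(xᵢ) h(vᵢ))²] = (N+1) (∫ χ²) ∫ h(√θ w)² dγ(w) = (N+1) (∫ χ²) ∫ h² M_θ`.

References: H. Spohn, *Large Scale Dynamics of Interacting Particles* (1991), Part I §2.3–2.4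
(local equilibrium states, product structure; the ideal-gas computation). Folklore otherwise.
-/

noncomputable section

namespace Summit.AtomisticToContinuum.HydrodynamicLimit.Theorems.MourreKoopmanChargesOneBodyCompleteness

open MeasureTheory ProbabilityTheory Filter Topology Set
open scoped ENNReal InnerProductSpace BigOperators
open Literature.Analysis.FluidPDE Literature.MathematicalPhysics.KineticTheory
open Summit.AtomisticToContinuum.HydrodynamicLimit.Theorems.MourreKoopmanChargesIdealGasNoDecay

/-! ### Transfer between `N(0, θ id)` (density `M_θ`) and the standard Gaussian `γ` -/

/-- Change of variables `v = √θ w`: `∫ g(√θ w) dγ(w) = ∫ g M_θ dv` (`θ > 0`). [folklore] -/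
theorem integral_comp_sqrt_smul_stdGaussian {θ : ℝ} (hθ : 0 < θ) (g : V3 → ℝ) :
    ∫ w, g (Real.sqrt θ • w) ∂stdGaussian V3 = ∫ v, g v * localMaxwellian 1 θ (0 : V3) v := by
  rw [← integral_gaussMeasure_eq_integral_mul hθ g, integral_gaussMeasure (0 : V3) hθ g]
  simp_rw [zero_add]

/-- A continuous velocity profile of polynomial growth, rescaled by `√θ`, is in `L²(γ)`
(`h ∈ L²(N(0, θ id))` and `N(0, θ id)` is the image of `γ` under `w ↦ √θ w`). [folklore] -/
theorem memLp_two_comp_sqrt_smul_stdGaussian (θ : ℝ) {h : V3 → ℝ} (hh : Continuous h) {C : ℝ}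
    {k : ℕ} (hCk : ∀ v, |h v| ≤ C * (1 + ‖v‖) ^ k) :
    MemLp (fun w => h (Real.sqrt θ • w)) 2 (stdGaussian V3) := by
  have h2 : MemLp h 2 (gaussMeasure (0 : V3) θ) := memLp_two_gaussMeasure_of_poly_growth θ hh hCk
  unfold gaussMeasure at h2
  have h3 := (memLp_map_measure_iff (μ := stdGaussian V3) hh.aestronglyMeasurable
    (measurable_gaussShift (0 : V3) θ).aemeasurable).1 h2
  exact h3.ae_eq (Eventually.of_forall fun w => by simp only [Function.comp_apply, zero_add])

/-! ### The registered sub-goal -/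

/-- **Sub-goal `torusStaticVariance`** of the line `registered` of crux stmt-AtomisticToContinuum-9583
(`OneBodyCompleteness`): under the canonical law `G = localGibbsLaw σ 1 0 θ N Φ` (`0 < σ < 1/2`,
`0 < θ`), the equal-time value of the rescaled two-time moment of the one-body empirical field
`A(z) = ∫ χ(y.1) h(y.2) d(empiricalMeasure z)` of a continuous polynomially bounded `h` with
`∫ h M_θ = 0` and a continuous `χ` is exactly `(N+1) · E_G[A(Φ_0 z) A(z)] = (∫ χ²) · ∫ h² M_θ` for
every `N` (`Φ_0 = id` `G`-a.e.; i.i.d. `N(0, θ id)` velocities independent of the positions, Haar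
one-particle position marginal, cross terms vanish since `∫ h M_θ = 0`). [folklore] -/
theorem torusStaticVariance : ∀ σ : ℝ, 0 < σ → σ < 1 / 2 → ∀ θ : ℝ, 0 < θ →
    ∀ h : Literature.MathematicalPhysics.KineticTheory.V3 → ℝ, Continuous h →
      (∃ (C : ℝ) (k : ℕ), ∀ v, |h v| ≤ C * (1 + ‖v‖) ^ k) →
      (∫ v, h v * Literature.Analysis.FluidPDE.localMaxwellian 1 θ
          (0 : Literature.MathematicalPhysics.KineticTheory.V3) v = 0) →
      ∀ (N : ℕ) (Φ : Literature.Analysis.FluidPDE.HardSphereFlow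
          (Literature.Analysis.FluidPDE.Torus.geometry (Fin 3))
          (Literature.MathematicalPhysics.KineticTheory.hsDiameter σ N) (N + 1))
        (χ : Literature.MathematicalPhysics.KineticTheory.T3 → ℝ), Continuous χ →
        ((N : ℝ) + 1) * ∫ z, (∫ y, χ y.1 * h y.2 ∂(Literature.Analysis.FluidPDE.empiricalMeasure
            (Φ.flow 0 z))) *
          (∫ y, χ y.1 * h y.2 ∂(Literature.Analysis.FluidPDE.empiricalMeasure z))
          ∂(Literature.MathematicalPhysics.KineticTheory.localGibbsLaw σ (fun _ => 1) (fun _ => 0)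
            (fun _ => θ) N Φ) =
        (∫ x, χ x * χ x) * ∫ v, h v ^ 2 * Literature.Analysis.FluidPDE.localMaxwellian 1 θ
          (0 : Literature.MathematicalPhysics.KineticTheory.V3) v := by
  intro σ hσ hσ2 θ hθ h hh hpoly h1 N Φ χ hχ
  obtain ⟨C, k, hCk⟩ := hpoly
  obtain ⟨Cχ, -, hCχ⟩ := exists_bound_of_continuous hχ
  -- (a) `Φ_0 = id` `G`-a.e.
  have h0 : ∫ z, (∫ y, χ y.1 * h y.2 ∂(empiricalMeasure (Φ.flow 0 z))) *
        (∫ y, χ y.1 * h y.2 ∂(empiricalMeasure z))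
        ∂(localGibbsLaw σ (fun _ => 1) (fun _ => 0) (fun _ => θ) N Φ) =
      ∫ z, (∫ y, χ y.1 * h y.2 ∂(empiricalMeasure z)) * (∫ y, χ y.1 * h y.2 ∂(empiricalMeasure z))
        ∂(localGibbsLaw σ (fun _ => 1) (fun _ => 0) (fun _ => θ) N Φ) := by
    refine integral_congr_ae ?_
    filter_upwards [ae_mem_good_localGibbsLaw σ (fun _ => 1) (fun _ => 0) (fun _ => θ) N Φ]
      with z hz
    rw [Φ.flow_zero z hz]
  rw [h0]
  -- (b) exact statics of the un-normalised sum `S(z) = Σᵢ χ(xᵢ) h(vᵢ)`, via `stub_gibbsStatics` for the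
  -- normalised test function `K⁻¹ χ` (`|K⁻¹ χ| ≤ 1`) and the rescaled profile `w ↦ h(√θ w)`
  obtain ⟨K, hK0, hKχ⟩ : ∃ K : ℝ, 0 < K ∧ ∀ x, |χ x| ≤ K :=
    ⟨max Cχ 1, lt_of_lt_of_le one_pos (le_max_right _ _), fun x => (hCχ x).trans (le_max_left _ _)⟩
  have hφc : Continuous fun x => K⁻¹ * χ x := continuous_const.mul hχ
  have hφb : ∀ x, |K⁻¹ * χ x| ≤ 1 := fun x => by
    rw [abs_mul, abs_inv, abs_of_pos hK0, inv_mul_le_iff₀ hK0, mul_one]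
    exact hKχ x
  have hfm : Measurable fun w : V3 => h (Real.sqrt θ • w) :=
    (hh.comp (continuous_const_smul _)).measurable
  have hf2 := memLp_two_comp_sqrt_smul_stdGaussian θ hh hCk
  have hfc : ∫ w, h (Real.sqrt θ • w) ∂stdGaussian V3 = 0 := by
    rw [integral_comp_sqrt_smul_stdGaussian hθ h, h1]
  have hsθ : Real.sqrt θ ≠ 0 := (Real.sqrt_pos.2 hθ).ne'
  have key := (BoltzmannGreenKuboGibbsStatics.stub_gibbsStatics 1 θ σ (0 : V3) one_pos hθ hσ hσ2.le
    (fun x => K⁻¹ * χ x) (fun w => h (Real.sqrt θ • w)) (fun w => h (Real.sqrt θ • w)) hφc hφb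
    hfm hfm hf2 hf2 hfc hfc N Φ).2.2
  simp only [sub_zero, smul_inv_smul₀ hsθ] at key
  have eS : ∀ z : Config (N + 1) (Fin 3) T3,
      ∑ i, K⁻¹ * χ (z i).1 * h (z i).2 = K⁻¹ * ∑ i, χ (z i).1 * h (z i).2 := fun z => by
    rw [Finset.mul_sum]
    exact Finset.sum_congr rfl fun i _ => mul_assoc _ _ _
  have e4 : ∫ w, h (Real.sqrt θ • w) * h (Real.sqrt θ • w) ∂stdGaussian V3 =
      ∫ v, h v ^ 2 * localMaxwellian 1 θ (0 : V3) v := by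
    rw [← integral_comp_sqrt_smul_stdGaussian hθ (fun v => h v ^ 2)]
    simp_rw [sq]
  have e5 : ∫ z, K⁻¹ * (∑ i, χ (z i).1 * h (z i).2) * (K⁻¹ * ∑ i, χ (z i).1 * h (z i).2)
        ∂(localGibbsLaw σ (fun _ => 1) (fun _ => 0) (fun _ => θ) N Φ) =
      K⁻¹ * K⁻¹ * ∫ z, (∑ i, χ (z i).1 * h (z i).2) * (∑ i, χ (z i).1 * h (z i).2)
        ∂(localGibbsLaw σ (fun _ => 1) (fun _ => 0) (fun _ => θ) N Φ) := by
    rw [← integral_const_mul]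
    refine integral_congr_ae (Eventually.of_forall fun z => ?_)
    simp only
    ring
  have e2 : ∫ x, (K⁻¹ * χ x) ^ 2 = K⁻¹ * K⁻¹ * ∫ x, χ x * χ x := by
    rw [← integral_const_mul]
    refine integral_congr_ae (Eventually.of_forall fun x => ?_)
    simp only
    ring
  simp_rw [eS] at key
  rw [e5, e2, e4] at key
  have hS : ∫ z, (∑ i, χ (z i).1 * h (z i).2) * (∑ i, χ (z i).1 * h (z i).2)
        ∂(localGibbsLaw σ (fun _ => 1) (fun _ => 0) (fun _ => θ) N Φ) =
      ((N : ℝ) + 1) * (∫ x, χ x * χ x) * ∫ v, h v ^ 2 * localMaxwellian 1 θ (0 : V3) v := by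
    have hKi : K⁻¹ * K⁻¹ ≠ 0 := by positivity
    refine mul_left_cancel₀ hKi ?_
    rw [key]
    ring
  -- (c) the normalisation `A = (N+1)⁻¹ S`
  simp_rw [oneBodyField_eq_sum χ h]
  have e6 : ∫ z, ((N + 1 : ℕ) : ℝ)⁻¹ * (∑ i, χ (z i).1 * h (z i).2) *
          (((N + 1 : ℕ) : ℝ)⁻¹ * ∑ i, χ (z i).1 * h (z i).2)
        ∂(localGibbsLaw σ (fun _ => 1) (fun _ => 0) (fun _ => θ) N Φ) =
      ((N + 1 : ℕ) : ℝ)⁻¹ * ((N + 1 : ℕ) : ℝ)⁻¹ *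
        ∫ z, (∑ i, χ (z i).1 * h (z i).2) * (∑ i, χ (z i).1 * h (z i).2)
          ∂(localGibbsLaw σ (fun _ => 1) (fun _ => 0) (fun _ => θ) N Φ) := by
    rw [← integral_const_mul]
    refine integral_congr_ae (Eventually.of_forall fun z => ?_)
    simp only
    ring
  rw [e6, hS]
  have hN : ((N : ℝ) + 1) ≠ 0 := by positivity
  push_cast
  field_simp

end Summit.AtomisticToContinuum.HydrodynamicLimit.Theorems.MourreKoopmanChargesOneBodyCompleteness

end
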